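import Summits.BirchSwinnertonDyer.BirchSwinnertonDyer.Theorems.KolyvaginDepthDoorDepthTableRow655a1RankDischarged
import Summits.BirchSwinnertonDyer.BirchSwinnertonDyer.Theorems.KolyvaginDepthDoorDepthTableRowsTwoSha1
import Summits.BirchSwinnertonDyer.BirchSwinnertonDyer.Theorems.KolyvaginDepthDoorDepthTableRowKitSecondSign
import Summits.BirchSwinnertonDyer.BirchSwinnertonDyer.Theorems.Rank2ObservatoryKernelAnnihilator
import Literature.NumberTheory.EllipticCurves.IrreducibleModPQuadraticTwistProofs
import Literature.NumberTheory.EllipticCurves.NonEisensteinPrimeOfSurjective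
import Literature.NumberTheory.EllipticCurves.LeadingTermProofs
import HarnessLib

/-!
# Route `KolyvaginDepthDoor`, crux `KolyvaginDepthSupplyKN` (stmt-BirchSwinnertonDyer-22820) —
# DEPTH TABLE v12: «ONE BIT ⟺ TWO `Ш`'s» for the row `655a1` at `(p, d_K) = (7, −51)` — the one point
# on the Heegner twist `E^{(−51)}` SUPPLIED IN THE KERNEL (sieved search; the v12 files of g15 had none)

Helper file of the lead prover of line `levelone` (kdd-p1 g16; `--supports stmt-BirchSwinnertonDyer-22820
--as helper`); it closes nothing and BSD is not proved by it.

v11 (`…DepthTableRow655a1RankDischarged`, g15) reads this rank-2 row as «bit ⟺ `Ш(E/ℚ)[7] = 0` ∧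
`#Sel_7(E^{(−51)}/ℚ) ≤ 7`». The remaining Selmer bound on the twist is itself two BSD invariants once ONE
rational point of infinite order on `E^{(−51)}` is known (`natCard_selmerGroup_le_iff_rank_eq_one_sha₁₅`,
file `…DepthTableRowsTwoSha1`: with `1 ≤ rank E'` and `E'[p]` irreducible, `#Sel_p(E') ≤ p` ⟺
«`rank E' = 1` ∧ `Ш(E')[p] = 0`», AEC X.4.2). g15's naive search found no point on this twist; a residue-
sieved search over `x = u/w²` (13 primes, `|u| ≤ 3·10⁷`) finds `(3844729/4, 7538734925/8)` on the integer
twist model `[0, −51 b₂, 0, 8·51² b₄, −16·51³ b₆] = [0, 0, 0, -541008, -154936368]` (`u = 1/2`-isomorphic to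
`E^{(−51)}`, bridge `mordellWeilRank_quadraticTwist_eq_twistModel`). The twist is TORSION-FREE by the
annihilator `t = 1` of the kernel point counts `#Ẽ(𝔽_7) = 5`, `#Ẽ(𝔽_11) = 16` (`nsmul_eq_zero_of_annihilatorCheck`),
so the point has infinite order and Mordell–Weil gives `1 ≤ rank E^{(−51)}(ℚ)`. RESULT:

  «∃ frame, Kolyvagin prime `ℓ`, datum: `c_1(ℓ) ≠ 0`»  `↔`
  «`Ш(E/ℚ)[7] = 0` ∧ `rank_ℤ E^{(−51)}(ℚ) = 1` ∧ `Ш(E^{(−51)}/ℚ)[7] = 0`»,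

for `E = 655a1` and ANY imaginary quadratic `K` with `d_K = −51`: one bit of Jetchev–Lauter–Stein's
algorithm IS the vanishing of `Ш[7]` of the rank-2 curve AND of its rank-1 Heegner twist, with nothing
else in the statement. CONDITIONAL on (γ) = Gross 1991 Prop. 3.7 (2) and W. Zhang 2014 Lemma 8.4 (1) /
Thm. 9.1 BY NAME (♠ cell, `7` inert); per curve; BSD is NOT proved by any of this. Depth table v12:
14/18 rows in the «two `Ш`» currency (g15: 13).

References: [WZhang2014] Lemma 8.4 (1) (p. 236), Thm. 9.1 (p. 240); [GrossLMS1991] Prop. 3.7 (2);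
[SilvermanAEC2009] VII.3.1 (b), VIII.6.7, X.4.2, X.5 Cor. 5.4; [JetchevLauterStein2009] §3.6
(arXiv:0707.0032); [CremonaAlgorithms1997] Table 1 (655a1), §3.5, §3.6.
-/

set_option linter.dupNamespace false

noncomputable section

open scoped Classical NumberField

namespace Summit.BirchSwinnertonDyer.BirchSwinnertonDyer.Theorems.KolyvaginDepthDoor

open Literature.NumberTheory.EllipticCurves Literature.NumberTheory.EllipticCurves.ModularForms
  WeierstrassCurve NumberField IsDedekindDomain
open Summit.BirchSwinnertonDyer.BirchSwinnertonDyer.Theorems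
open Summit.BirchSwinnertonDyer.BirchSwinnertonDyer.Rank2Observatory

/-! ## `655a1` at `(p, d_K) = (7, -51)`: twist model `[0, 0, 0, -541008, -154936368]`, kernel point `(3844729/4, 7538734925/8)` -/

namespace C655a1

/-- The twist model of `E^{(−51)}` for `E = 655a1`: `[0, −51 b₂, 0, 8·51² b₄, −16·51³ b₆] = [0, 0, 0, -541008, -154936368]`
(`ℚ`-isomorphic to `E^{(−51)}` by `u = 1/2`). [cite: SilvermanAEC2009, X.5 Cor. 5.4] -/
theorem twistModel_neg51 :
    (⟨0, (-51) * (⟨0, 0, 1, -13, 18⟩ : WeierstrassCurve ℤ).b₂, 0, 8 * (-51) ^ 2 * (⟨0, 0, 1, -13, 18⟩ : WeierstrassCurve ℤ).b₄,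
        16 * (-51) ^ 3 * (⟨0, 0, 1, -13, 18⟩ : WeierstrassCurve ℤ).b₆⟩ : WeierstrassCurve ℤ) = ⟨0, 0, 0, -541008, -154936368⟩ := by
  ext <;> decide +kernel

/-- The twist model `[0, 0, 0, -541008, -154936368]` is an elliptic curve over `ℚ` (`Δ ≠ 0`, kernel-checked). [folklore] -/
theorem isElliptic_twist_neg51 : ((⟨0, 0, 0, -541008, -154936368⟩ : WeierstrassCurve ℤ).map (Int.castRingHom ℚ)).IsElliptic := by
  rw [WeierstrassCurve.isElliptic_iff, WeierstrassCurve.map_Δ, isUnit_iff_ne_zero, eq_intCast,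
    Int.cast_ne_zero]
  decide +kernel

/-- Torsion killers for the twist model `[0, 0, 0, -541008, -154936368]`: kernel point counts `(q, #Ṽ(𝔽_q))` at the good
primes `(7, 5), (11, 16)`. [cite: SilvermanAEC2009, Prop. VII.3.1 (b)] -/
theorem killers_twist_neg51 : ∀ ℓN ∈ [((7 : ℕ), (5 : ℕ)), ((11 : ℕ), (16 : ℕ))], ℓN.1.Prime ∧
    ∀ (x : ((⟨0, 0, 0, -541008, -154936368⟩ : WeierstrassCurve ℤ).map (Int.castRingHom ℚ)).toAffine.Point)
      (n : ℕ), ¬ ℓN.1 ∣ n → n • x = 0 → ℓN.2 • x = 0 :=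
  killers_cons _ (q := 7) (N := 5) (by decide +kernel) (by decide +kernel)
    (killers_cons _ (q := 11) (N := 16) (by decide +kernel) (by decide +kernel)
      (killers_nil _))

/-- **`E^{(−51)}(ℚ)` is torsion-free** (`E = 655a1`; twist model `[0, 0, 0, -541008, -154936368]`; annihilator `t = 1` from the
kernel counts `(7, 5), (11, 16)`). [cite: SilvermanAEC2009, Prop. VII.3.1 (b)] -/
theorem torsionFree_twist_neg51 (x : ((⟨0, 0, 0, -541008, -154936368⟩ : WeierstrassCurve ℤ).map (Int.castRingHom ℚ)).toAffine.Point)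
    (hx : IsOfFinAddOrder x) : x = 0 := by
  simpa only [one_smul] using
    nsmul_eq_zero_of_annihilatorCheck (t := 1) killers_twist_neg51 (by decide +kernel) hx

/-- **`1 ≤ rank_ℤ E^{(−51)}(ℚ)` for `E = 655a1` IN THE KERNEL**: the rational point `(3844729/4, 7538734925/8)` of the
twist model `[0, 0, 0, -541008, -154936368]` (residue-sieved search over `x = u/w²`, `|u| ≤ 3·10⁷`) is non-zero on a
torsion-free curve, hence of infinite order; Mordell–Weil. [cite: SilvermanAEC2009, Prop. VII.3.1 (b) and Thm. VIII.6.7] -/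
theorem one_le_rank_twist_neg51 :
    1 ≤ ((⟨0, 0, 0, -541008, -154936368⟩ : WeierstrassCurve ℤ).map (Int.castRingHom ℚ)).mordellWeilRank := by
  haveI := isElliptic_twist_neg51
  have hP : ((⟨0, 0, 0, -541008, -154936368⟩ : WeierstrassCurve ℤ).map (Int.castRingHom ℚ)).toAffine.Nonsingular
      ((3844729 / 4 : ℚ)) ((7538734925 / 8 : ℚ)) :=
    WeierstrassCurve.Affine.equation_iff_nonsingular.mp
      ((WeierstrassCurve.Affine.equation_iff _ _).mpr (by norm_num [WeierstrassCurve.map]))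
  exact one_le_mordellWeilRank_of_not_isOfFinAddOrder _
    (((⟨0, 0, 0, -541008, -154936368⟩ : WeierstrassCurve ℤ).map (Int.castRingHom ℚ)).module_finite_point_holds)
    (fun hfin ↦ WeierstrassCurve.Affine.Point.some_ne_zero hP (torsionFree_twist_neg51 _ (by convert hfin)))

/-- **DEPTH-TABLE ROW `655a1`, `(p, d_K) = (7, −51)`, v12 — «ONE BIT ⟺ TWO `Ш`'s».** For `E = 655a1` and ANY
imaginary quadratic `K` with `d_K = −51`: «some frame, some Kolyvagin prime `ℓ`, some datum of conductor
`ℓ` with `c_1(ℓ) ≠ 0`» `↔` «`Ш(E/ℚ)[7] = 0` ∧ `rank_ℤ E^{(−51)}(ℚ) = 1` ∧ `Ш(E^{(−51)}/ℚ)[7] = 0`». From the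
v11 row `C655a1.exactRowZhang_7_neg51_rankFree` (rank of `E` discharged by the kernel 2-descent certificate) and
`natCard_selmerGroup_le_iff_rank_eq_one_sha₁₅` at the twist, fed with the kernel point `one_le_rank_twist_neg51`
(through `mordellWeilRank_quadraticTwist_eq_twistModel`) and the irreducibility of `E^{(−51)}[7]` (twist of the
onto `ρ̄_{E,7}`). Every side condition is a kernel theorem; CONDITIONAL on (γ) and W. Zhang's Lemma 8.4 (1) /
Thm. 9.1 by name (♠ cell, `7` inert in `K`); per curve; BSD is not proved by it.
[cite: WZhang2014, Lemma 8.4 (1) (p. 236), Thm. 9.1 (p. 240)] [cite: GrossLMS1991, Prop. 3.7 (2)]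
[cite: SilvermanAEC2009, Thm. X.4.2] [cite: CremonaAlgorithms1997, Table 1 (655a1)] -/
theorem exactRowZhang_7_neg51_twoSha
    (h372 : GrossLMS1991.prop37_2_frobeniusCongruence)
    (h84 : Literature.NumberTheory.EllipticCurves.WZhang2014_lemma84_exists_minimal_kolyvaginClass_one_selmerCard)
    (K : Type) [Field K] [NumberField K] (hK : IsImaginaryQuadratic K)
    (hD : NumberField.discr K = -51) :
    haveI := isElliptic_c655a1;
    haveI := isGloballyMinimal_c655a1;
    haveI : NeZero (((⟨0, 0, 1, -13, 18⟩ : WeierstrassCurve ℤ).map (Int.castRingHom ℚ)).conductorNorm ℤ) := neZero_conductorNorm_of_isElliptic _;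
    haveI := Fact.mk (by norm_num : Nat.Prime 7);
    (∃ (Dt : ModularParametrizationData ((⟨0, 0, 1, -13, 18⟩ : WeierstrassCurve ℤ).map (Int.castRingHom ℚ)) (((⟨0, 0, 1, -13, 18⟩ : WeierstrassCurve ℤ).map (Int.castRingHom ℚ)).conductorNorm ℤ)) (β : ℤ)
      (ι : K →+* ℂ) (ℓ : ℕ) (d : KolyvaginHeegnerData Dt β ι ℓ),
      ℓ.Prime ∧ Zhang2014.IsKolyvaginPrime (((⟨0, 0, 1, -13, 18⟩ : WeierstrassCurve ℤ).map (Int.castRingHom ℚ)).conductorNorm ℤ) ((⟨0, 0, 1, -13, 18⟩ : WeierstrassCurve ℤ).map (Int.castRingHom ℚ)) K 7 ℓ ∧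
        d.kolyvaginClass (p := 7) (by norm_num) 1 ≠ 0) ↔
    ((((⟨0, 0, 1, -13, 18⟩ : WeierstrassCurve ℤ).map (Int.castRingHom ℚ)).sha ⊓ AddSubgroup.torsionBy ((⟨0, 0, 1, -13, 18⟩ : WeierstrassCurve ℤ).map (Int.castRingHom ℚ)).galH1 ((7 : ℕ) : ℤ) : AddSubgroup _) = ⊥ ∧
      (((⟨0, 0, 1, -13, 18⟩ : WeierstrassCurve ℤ).map (Int.castRingHom ℚ)).quadraticTwist (NumberField.discr K : ℚ)).mordellWeilRank = 1 ∧
      ((((⟨0, 0, 1, -13, 18⟩ : WeierstrassCurve ℤ).map (Int.castRingHom ℚ)).quadraticTwist (NumberField.discr K : ℚ)).sha ⊓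
          AddSubgroup.torsionBy (((⟨0, 0, 1, -13, 18⟩ : WeierstrassCurve ℤ).map (Int.castRingHom ℚ)).quadraticTwist (NumberField.discr K : ℚ)).galH1 ((7 : ℕ) : ℤ) :
          AddSubgroup (((⟨0, 0, 1, -13, 18⟩ : WeierstrassCurve ℤ).map (Int.castRingHom ℚ)).quadraticTwist (NumberField.discr K : ℚ)).galH1) = ⊥) := by
  haveI := isElliptic_c655a1
  haveI := isGloballyMinimal_c655a1
  haveI : NeZero (((⟨0, 0, 1, -13, 18⟩ : WeierstrassCurve ℤ).map (Int.castRingHom ℚ)).conductorNorm ℤ) := neZero_conductorNorm_of_isElliptic _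
  haveI := Fact.mk (by norm_num : Nat.Prime 7)
  have hdK : (NumberField.discr K : ℚ) ≠ 0 := by exact_mod_cast NumberField.discr_ne_zero K
  haveI := ((⟨0, 0, 1, -13, 18⟩ : WeierstrassCurve ℤ).map (Int.castRingHom ℚ)).isElliptic_quadraticTwist hdK
  have hsur : ((⟨0, 0, 1, -13, 18⟩ : WeierstrassCurve ℤ).map (Int.castRingHom ℚ)).HasSurjectiveModNGaloisRep (7 ^ 1 : ℕ) := hasSurjectiveModNGaloisRep_pow_7 1
  rw [pow_one] at hsur
  have hirrT : (((⟨0, 0, 1, -13, 18⟩ : WeierstrassCurve ℤ).map (Int.castRingHom ℚ)).quadraticTwist (NumberField.discr K : ℚ)).HasIrreducibleModPGaloisRep 7 :=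
    (((⟨0, 0, 1, -13, 18⟩ : WeierstrassCurve ℤ).map (Int.castRingHom ℚ)).hasIrreducibleModPGaloisRep_quadraticTwist_iff hdK 7).mpr
      (hasIrreducibleModPGaloisRep_of_hasSurjectiveModNGaloisRep ((⟨0, 0, 1, -13, 18⟩ : WeierstrassCurve ℤ).map (Int.castRingHom ℚ)) 7 hsur)
  have h1 : 1 ≤ (((⟨0, 0, 1, -13, 18⟩ : WeierstrassCurve ℤ).map (Int.castRingHom ℚ)).quadraticTwist (NumberField.discr K : ℚ)).mordellWeilRank := by
    rw [hD, mordellWeilRank_quadraticTwist_eq_twistModel intModel (-51), twistModel_neg51]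
    exact one_le_rank_twist_neg51
  exact (exactRowZhang_7_neg51_rankFree h372 h84 K hK hD).trans
    (and_congr_right fun _ ↦ natCard_selmerGroup_le_iff_rank_eq_one_sha₁₅ _ 7 hirrT h1)

end C655a1

end Summit.BirchSwinnertonDyer.BirchSwinnertonDyer.Theorems.KolyvaginDepthDoor

end
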